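import Literature.Analysis.FluidPDE.NSFourierPicard
import HarnessLib

/-!
# Fourier-side mild solutions on a time interval: restriction, translation, gluing

Continuation-argument companion to the Fourier-side (pseudo-measure) construction of Leray's
local regular solution (`NSFourierWeights` → `NSFourierBilinear` → `NSFourierPicard`, unit
`local_classical_lerayHopf`). The Picard limit `v = picardLimit c T a` solves the Duhamel
(mild) equation from time `0`,

  `v(t, ξ) = e^{-c‖ξ‖²t} a(ξ) − ∫₀ᵗ e^{-c‖ξ‖²(t-s)} N(v(s), v(s))(ξ) ds`   (`0 ≤ t ≤ T`),

hence, by the semigroup law `e^{-c‖ξ‖²(t-r)} = e^{-c‖ξ‖²(t-s)} e^{-c‖ξ‖²(s-r)}` and additivity of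
the time integral, the same equation *between any two times* `s ≤ t` of `[0, T]`:

  `v(t, ξ) = e^{-c‖ξ‖²(t-s)} v(s, ξ) − ∫ₛᵗ e^{-c‖ξ‖²(t-r)} N(v(r), v(r))(ξ) dr`.

This two-time form is the notion that restricts to sub-intervals, translates in time and
**glues**: if `V` is mild on `[t₀, t']`, `W` is mild on `[t', t₁]` and `V(t') = W(t')`, the
concatenation is mild on `[t₀, t₁]`. It is the bookkeeping device of the classical continuation
argument for Leray's regular solutions (Leray 1934, §21: a regular solution on `[0, T)` is
continued by restarting the local construction from `u(t₁)`, `t₁ < T`, and the uniqueness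
theorem; Ożański–Pooley 2018, §6.3.3 and Cor. 6.25; in the mild/Fourier setting
Lemarié-Rieusset 2016, Thm. 7.2 (`T_MAX` and restarting for mild solutions)). This file
introduces the predicate `IsFourierMild c K₀ t₀ t₁ V` (joint continuity, decay of every
polynomial order uniformly in time, the two-time Duhamel identity on `[t₀, t₁]`, incompressibility
and conjugation symmetry on the Fourier side) and proves:

* `PicardHyp.isFourierMild_limit`: the Picard limit is mild on `[0, T]`, `T = picardTime`;
* `IsFourierMild.mono`, `IsFourierMild.translate`, `IsFourierMild.glue`.

The a priori estimates that make the continuation argument work (control of the weighted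
sup-norms of `V(t)` by energy-class quantities of the synthesized velocity) are in
`NSFourierAPriori`.

## Mathlib search

`intervalIntegral.integral_add_adjacent_intervals`, `intervalIntegral.integral_comp_sub_right`,
`intervalIntegral.integral_smul`, `intervalIntegral.integral_congr`, `Continuous.if_le`,
`Real.exp_add`. Mathlib has no mild Navier–Stokes solutions (searched `Duhamel`, `mild`).

## References

* J. Leray, *Sur le mouvement d'un liquide visqueux emplissant l'espace*, Acta Math. 63 (1934),
  §19 (local regular solution), §21 (continuation and the maximal interval). [Leray1934]
* W. S. Ożański, B. C. Pooley, *Leray's fundamental work on the Navier–Stokes equations*, LMS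
  LN 452, CUP 2018, §6.3.3, Cor. 6.25. [OzanskiPooley2018]
* P. G. Lemarié-Rieusset, *The Navier–Stokes problem in the 21st century*, CRC 2016, §7.3,
  Thm. 7.2; §8.5 (pseudo-measure setting).
-/

noncomputable section

open MeasureTheory Real Set Filter Topology Function intervalIntegral
open scoped ComplexConjugate

namespace Literature.Analysis.FluidPDE.FourierNS

variable {ι : Type*} [Fintype ι] [DecidableEq ι]

/-! ### The heat factor as a semigroup -/

omit [Fintype ι] [DecidableEq ι] in
/-- Semigroup law of the heat factor: `e^{-c‖ξ‖²(t+s)} = e^{-c‖ξ‖²t} e^{-c‖ξ‖²s}`. [folklore] -/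
theorem heat_add {E : Type*} [NormedAddCommGroup E] (c : ℝ) (ξ : E) (t s : ℝ) :
    heat c ξ (t + s) = heat c ξ t * heat c ξ s := by
  simp only [heat, ← Real.exp_add]
  congr 1; ring

omit [Fintype ι] [DecidableEq ι] in
/-- `e^{-c‖ξ‖²(t-r)} = e^{-c‖ξ‖²(t-s)} e^{-c‖ξ‖²(s-r)}`. [folklore] -/
theorem heat_sub_sub {E : Type*} [NormedAddCommGroup E] (c : ℝ) (ξ : E) (t s r : ℝ) :
    heat c ξ (t - r) = heat c ξ (t - s) * heat c ξ (s - r) := by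
  rw [← heat_add]; congr 1; ring

/-! ### Mild solutions of the transformed system on `[t₀, t₁]` -/

/-- **Fourier-side mild solution on `[t₀, t₁]`.** A coefficient field
`V : ℝ → E → ℂ^ι` (`E = EuclideanSpace ℝ ι`), jointly continuous, with decay of every polynomial
order uniformly in time (order `K₀ > card ι` being the integrable one), divergence free
(`∑ₗ ξₗ Vₗ = 0`) and conjugation symmetric (`V(t,-ξ) = conj V(t,ξ)`, reality of the synthesis),
which satisfies the Duhamel formula of the transformed Navier–Stokes system with heat rate `c`
between any two times `t₀ ≤ s ≤ t ≤ t₁`: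
`V(t, ξ) = e^{-c‖ξ‖²(t-s)} V(s, ξ) − ∫ₛᵗ e^{-c‖ξ‖²(t-r)} N(V(r), V(r))(ξ) dr`
(Lemarié-Rieusset 2016, §7.3/§8.5: mild solutions and their restarting; the Picard limit of
`NSFourierPicard` is the basic example, `PicardHyp.isFourierMild_limit`). [folklore] -/
structure IsFourierMild (c : ℝ) (K₀ : ℕ) (t₀ t₁ : ℝ)
    (V : ℝ → EuclideanSpace ℝ ι → ι → ℂ) : Prop where
  /-- positivity of the heat rate `c = 4π²ν` -/
  hc : 0 < c
  /-- the weights of order `K₀` are integrable -/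
  hK₀ : Fintype.card ι < K₀
  /-- the interval is nonempty -/
  le : t₀ ≤ t₁
  /-- joint continuity in `(t, ξ)` -/
  cont : Continuous (uncurry V)
  /-- decay of every polynomial order, uniformly in time -/
  decay : ∀ K : ℕ, ∃ A : ℝ, ∀ t, HasDecay K A (V t)
  /-- the two-time Duhamel formula on `[t₀, t₁]` -/
  duhamel : ∀ ⦃s t : ℝ⦄, t₀ ≤ s → s ≤ t → t ≤ t₁ → ∀ ξ,
    V t ξ = heat c ξ (t - s) • V s ξ -
      ∫ r in s..t, heat c ξ (t - r) • nonlin (V r) (V r) ξ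
  /-- incompressibility on the Fourier side -/
  divFree : ∀ t ξ, ∑ l, (ξ l : ℂ) * V t ξ l = 0
  /-- conjugation symmetry (reality of `𝓕 V(t)`) -/
  conjSymm : ∀ t ξ l, V t (-ξ) l = conj (V t ξ l)

namespace IsFourierMild

variable {c t₀ t₁ : ℝ} {K₀ : ℕ} {V W : ℝ → EuclideanSpace ℝ ι → ι → ℂ}

/-- Time slices are continuous. [folklore] -/
theorem continuous_slice (h : IsFourierMild c K₀ t₀ t₁ V) (t : ℝ) : Continuous (V t) :=
  h.cont.uncurry_left t

/-- Time slices are a.e.-strongly measurable. [folklore] -/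
theorem aestronglyMeasurable_slice (h : IsFourierMild c K₀ t₀ t₁ V) (t : ℝ) :
    AEStronglyMeasurable (V t) volume :=
  (h.continuous_slice t).aestronglyMeasurable

/-- At a fixed frequency the coefficient is continuous in time. [folklore] -/
theorem continuous_time (h : IsFourierMild c K₀ t₀ t₁ V) (ξ : EuclideanSpace ℝ ι) :
    Continuous fun t => V t ξ := by
  have : (fun t => V t ξ) = uncurry V ∘ fun t => (t, ξ) := rfl
  rw [this]; exact h.cont.comp (by fun_prop)

/-- A uniform decay bound of the integrable order, with a nonnegative constant. [folklore] -/
theorem decay₀ (h : IsFourierMild c K₀ t₀ t₁ V) : ∃ A : ℝ, 0 ≤ A ∧ ∀ t, HasDecay K₀ A (V t) := by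
  obtain ⟨A, hA⟩ := h.decay K₀
  exact ⟨A, (hA t₀).nonneg, hA⟩

/-- Time slices are integrable. [folklore] -/
theorem integrable_slice (h : IsFourierMild c K₀ t₀ t₁ V) (t : ℝ) : Integrable (V t) := by
  obtain ⟨A, -, hA⟩ := h.decay₀
  exact (hA t).integrable (finrank_lt_of_card_lt h.hK₀) (h.aestronglyMeasurable_slice t)

/-- The nonlinearity is continuous in time at a fixed frequency. [folklore] -/
theorem continuous_nonlin_time (h : IsFourierMild c K₀ t₀ t₁ V) (ξ : EuclideanSpace ℝ ι) :
    Continuous fun r : ℝ => nonlin (V r) (V r) ξ := by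
  obtain ⟨A, -, hA⟩ := h.decay₀
  exact FourierNS.continuous_nonlin_time h.hK₀ h.cont hA ξ

/-- The Duhamel integrand `r ↦ e^{-c‖ξ‖²(τ-r)} N(V r, V r)(ξ)` is continuous. [folklore] -/
theorem continuous_integrand (h : IsFourierMild c K₀ t₀ t₁ V) (τ : ℝ) (ξ : EuclideanSpace ℝ ι) :
    Continuous fun r : ℝ => heat c ξ (τ - r) • nonlin (V r) (V r) ξ := by
  obtain ⟨A, -, hA⟩ := h.decay₀
  exact continuous_duhamel_integrand_time h.hK₀ h.cont hA τ ξ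

/-- The Duhamel integrand is interval integrable on every interval. [folklore] -/
theorem intervalIntegrable_integrand (h : IsFourierMild c K₀ t₀ t₁ V) (τ : ℝ)
    (ξ : EuclideanSpace ℝ ι) (a b : ℝ) :
    IntervalIntegrable (fun r : ℝ => heat c ξ (τ - r) • nonlin (V r) (V r) ξ) volume a b :=
  (h.continuous_integrand τ ξ).intervalIntegrable a b

/-- The nonlinearity is jointly continuous in `(t, ξ)`. [folklore] -/
theorem continuous_nonlin (h : IsFourierMild c K₀ t₀ t₁ V) :
    Continuous fun p : ℝ × EuclideanSpace ℝ ι => nonlin (V p.1) (V p.1) p.2 := by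
  obtain ⟨A, -, hA⟩ := h.decay₀
  have hslice : ∀ s, AEStronglyMeasurable (V s) volume := h.aestronglyMeasurable_slice
  have hVc : ∀ η, Continuous fun p : ℝ × EuclideanSpace ℝ ι => V p.1 η := fun η => by
    have : (fun p : ℝ × EuclideanSpace ℝ ι => V p.1 η) = uncurry V ∘ fun p => (p.1, η) := rfl
    rw [this]; exact h.cont.comp (by fun_prop)
  have hWc : ∀ η, Continuous fun p : ℝ × EuclideanSpace ℝ ι => V p.1 (p.2 - η) := fun η => by
    have : (fun p : ℝ × EuclideanSpace ℝ ι => V p.1 (p.2 - η)) =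
        uncurry V ∘ fun p => (p.1, p.2 - η) := rfl
    rw [this]; exact h.cont.comp (by fun_prop)
  exact continuous_nonlin_param (X := ℝ × EuclideanSpace ℝ ι) h.hK₀ (V := fun p => V p.1)
    (W := fun p => V p.1) (ζ := fun p => p.2) (fun p => hslice p.1) (fun p => hslice p.1)
    (fun p => hA p.1) (fun p => hA p.1) hVc hWc continuous_snd

/-- Uniform decay of the nonlinearity of every order: `‖N(V r, V r)(ξ)‖ ≤ C_K ‖ξ‖ (1+‖ξ‖)^{-K}`
for all `r`. [folklore] -/
theorem norm_nonlin_le (h : IsFourierMild c K₀ t₀ t₁ V) (K : ℕ) :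
    ∃ C : ℝ, 0 ≤ C ∧ ∀ r ξ, ‖nonlin (V r) (V r) ξ‖ ≤ C * ‖ξ‖ * ((1 + ‖ξ‖) ^ K)⁻¹ := by
  obtain ⟨A₀, hA₀0, hA₀⟩ := h.decay₀
  obtain ⟨A, hA⟩ := h.decay K
  have hA0 : 0 ≤ A := (hA t₀).nonneg
  refine ⟨nonlinConst ι K K₀ * (A * A₀ + A₀ * A), by
    have := nonlinConst_nonneg (ι := ι) K K₀; positivity, fun r ξ => ?_⟩
  exact norm_nonlin_le_mixed h.hK₀ (hA₀ r) (hA r) (hA₀ r) (hA r)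
    (h.aestronglyMeasurable_slice r) (h.aestronglyMeasurable_slice r) ξ

/-! ### Restriction and translation -/

/-- Restriction to a sub-interval. [folklore] -/
theorem mono (h : IsFourierMild c K₀ t₀ t₁ V) {s₀ s₁ : ℝ} (h₀ : t₀ ≤ s₀) (h₀₁ : s₀ ≤ s₁)
    (h₁ : s₁ ≤ t₁) : IsFourierMild c K₀ s₀ s₁ V where
  hc := h.hc
  hK₀ := h.hK₀
  le := h₀₁
  cont := h.cont
  decay := h.decay
  duhamel := fun _ _ hs hst ht ξ => h.duhamel (h₀.trans hs) hst (ht.trans h₁) ξ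
  divFree := h.divFree
  conjSymm := h.conjSymm

/-- **Time translation**: `t ↦ V(t - d)` is mild on `[t₀ + d, t₁ + d]`. [folklore] -/
theorem translate (h : IsFourierMild c K₀ t₀ t₁ V) (d : ℝ) :
    IsFourierMild c K₀ (t₀ + d) (t₁ + d) (fun t => V (t - d)) where
  hc := h.hc
  hK₀ := h.hK₀
  le := by linarith [h.le]
  cont := by
    have : uncurry (fun t => V (t - d)) = uncurry V ∘ fun p : ℝ × EuclideanSpace ℝ ι =>
        (p.1 - d, p.2) := by
      funext p; rfl
    rw [this]; exact h.cont.comp (by fun_prop)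
  decay := fun K => by
    obtain ⟨A, hA⟩ := h.decay K
    exact ⟨A, fun t => hA (t - d)⟩
  duhamel := by
    intro s t hs hst ht ξ
    have hD := h.duhamel (s := s - d) (t := t - d) (by linarith) (by linarith) (by linarith) ξ
    have hsub : t - d - (s - d) = t - s := by ring
    rw [hsub] at hD
    rw [hD]
    congr 1
    rw [← intervalIntegral.integral_comp_sub_right
      (fun r => heat c ξ (t - d - r) • nonlin (V r) (V r) ξ) d]
    refine intervalIntegral.integral_congr fun r _ => ?_
    show heat c ξ (t - d - (r - d)) • nonlin (V (r - d)) (V (r - d)) ξ =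
      heat c ξ (t - r) • nonlin (V (r - d)) (V (r - d)) ξ
    rw [show t - d - (r - d) = t - r by ring]
  divFree := fun t ξ => h.divFree (t - d) ξ
  conjSymm := fun t ξ l => h.conjSymm (t - d) ξ l

/-! ### Gluing -/

/-- **Gluing two mild solutions that agree at the junction.** If `V` is mild on `[t₀, t']`,
`W` is mild on `[t', t₁]` (same rate and order) and `V(t') = W(t')`, then
`t ↦ if t ≤ t' then V t else W t` is mild on `[t₀, t₁]`: for `s ≤ t' ≤ t` the Duhamel formulas
of `W` on `[t', t]` and of `V` on `[s, t']` combine by the semigroup law of the heat factor and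
additivity of the time integral (the restarting step of the continuation argument; Leray 1934,
§21; Lemarié-Rieusset 2016, Thm. 7.2). [folklore] -/
theorem glue {t' : ℝ} (hV : IsFourierMild c K₀ t₀ t' V) (hW : IsFourierMild c K₀ t' t₁ W)
    (hVW : V t' = W t') :
    IsFourierMild c K₀ t₀ t₁ (fun t => if t ≤ t' then V t else W t) := by
  obtain ⟨G, hG⟩ : ∃ G : ℝ → EuclideanSpace ℝ ι → ι → ℂ,
      ∀ t, G t = if t ≤ t' then V t else W t := ⟨_, fun t => rfl⟩
  have hGfun : (fun t => if t ≤ t' then V t else W t) = G := funext fun t => (hG t).symm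
  rw [hGfun]
  -- pointwise descriptions of the glued field
  have hGle : ∀ {t}, t ≤ t' → G t = V t := fun {t} ht => by rw [hG t, if_pos ht]
  have hGge : ∀ {t}, t' ≤ t → G t = W t := fun {t} ht => by
    rcases eq_or_lt_of_le ht with h | h
    · rw [← h, hGle le_rfl, hVW]
    · rw [hG t, if_neg (not_le.2 h)]
  -- continuity
  have hcont : Continuous (uncurry G) := by
    have hV' : Continuous fun p : ℝ × EuclideanSpace ℝ ι => V p.1 p.2 := hV.cont
    have hW' : Continuous fun p : ℝ × EuclideanSpace ℝ ι => W p.1 p.2 := hW.cont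
    have : uncurry G = fun p : ℝ × EuclideanSpace ℝ ι =>
        if p.1 ≤ t' then V p.1 p.2 else W p.1 p.2 := by
      funext p
      simp only [uncurry, hG p.1]
      split_ifs <;> rfl
    rw [this]
    refine Continuous.if_le hV' hW' continuous_fst continuous_const ?_
    rintro ⟨t, ξ⟩ (ht : t = t')
    simp only [ht, hVW]
  -- decay
  have hdecay : ∀ K : ℕ, ∃ A : ℝ, ∀ t, HasDecay K A (G t) := fun K => by
    obtain ⟨A, hA⟩ := hV.decay K
    obtain ⟨B, hB⟩ := hW.decay K
    refine ⟨max A B, fun t => ?_⟩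
    by_cases ht : t ≤ t'
    · rw [hGle ht]; exact (hA t).mono (le_max_left _ _)
    · rw [hGge (not_le.1 ht).le]; exact (hB t).mono (le_max_right _ _)
  refine
    { hc := hV.hc
      hK₀ := hV.hK₀
      le := hV.le.trans hW.le
      cont := hcont
      decay := hdecay
      duhamel := ?_
      divFree := fun t ξ => ?_
      conjSymm := fun t ξ l => ?_ }
  · intro s t hs hst ht ξ
    -- the integrand of the glued field agrees with that of `V` on `[t₀, t']`, of `W` on `[t', t₁]`
    have hintV : ∀ {τ a b : ℝ}, a ≤ b → b ≤ t' →
        ∫ r in a..b, heat c ξ (τ - r) • nonlin (G r) (G r) ξ =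
          ∫ r in a..b, heat c ξ (τ - r) • nonlin (V r) (V r) ξ := by
      intro τ a b hab hb
      refine intervalIntegral.integral_congr fun r hr => ?_
      rw [uIcc_of_le hab] at hr
      simp only [hGle (hr.2.trans hb)]
    have hintW : ∀ {τ a b : ℝ}, t' ≤ a → a ≤ b →
        ∫ r in a..b, heat c ξ (τ - r) • nonlin (G r) (G r) ξ =
          ∫ r in a..b, heat c ξ (τ - r) • nonlin (W r) (W r) ξ := by
      intro τ a b ha hab
      refine intervalIntegral.integral_congr fun r hr => ?_
      rw [uIcc_of_le hab] at hr
      simp only [hGge (ha.trans hr.1)]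
    rcases le_total t t' with htt' | htt'
    · -- both times in `[t₀, t']`
      rw [hGle htt', hGle (hst.trans htt'), hintV hst htt']
      exact hV.duhamel hs hst htt' ξ
    rcases le_total t' s with ht's | ht's
    · -- both times in `[t', t₁]`
      rw [hGge htt', hGge ht's, hintW ht's hst]
      exact hW.duhamel ht's hst ht ξ
    · -- `s ≤ t' ≤ t`: combine
      have h1 := hW.duhamel le_rfl htt' ht ξ
      have h2 := hV.duhamel hs ht's le_rfl ξ
      rw [hGge htt', hGle ht's, h1, ← hVW, h2]
      have hIG : IntervalIntegrable (fun r => heat c ξ (t - r) • nonlin (G r) (G r) ξ)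
          volume s t' ∧
          IntervalIntegrable (fun r => heat c ξ (t - r) • nonlin (G r) (G r) ξ) volume t' t := by
        obtain ⟨A, hA⟩ := hdecay K₀
        have hc := continuous_duhamel_integrand_time (c := c) hV.hK₀ hcont hA t ξ
        exact ⟨hc.intervalIntegrable _ _, hc.intervalIntegrable _ _⟩
      rw [← intervalIntegral.integral_add_adjacent_intervals hIG.1 hIG.2, hintV ht's le_rfl,
        hintW le_rfl htt', smul_sub, ← intervalIntegral.integral_smul, smul_smul,
        ← heat_sub_sub]
      have hI : ∫ r in s..t', heat c ξ (t - t') • heat c ξ (t' - r) • nonlin (V r) (V r) ξ =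
          ∫ r in s..t', heat c ξ (t - r) • nonlin (V r) (V r) ξ := by
        refine intervalIntegral.integral_congr fun r _ => ?_
        simp only [smul_smul, ← heat_sub_sub]
      rw [hI]
      abel
  · by_cases ht : t ≤ t'
    · rw [hGle ht]; exact hV.divFree t ξ
    · rw [hGge (not_le.1 ht).le]; exact hW.divFree t ξ
  · by_cases ht : t ≤ t'
    · rw [hGle ht]; exact hV.conjSymm t ξ l
    · rw [hGge (not_le.1 ht).le]; exact hW.conjSymm t ξ l

end IsFourierMild

/-! ### The Picard limit is mild -/

section Picard

variable {c T : ℝ} {K₀ : ℕ} {R : ℝ} {a : EuclideanSpace ℝ ι → ι → ℂ}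

/-- **The Picard limit is a Fourier-side mild solution on `[0, T]`**, `T = picardTime`, for
data with every polynomial decay, divergence free and conjugation symmetric: the fixed-point
identity `v = Φ(v)` is the Duhamel formula from time `0`, and the two-time form follows from the
semigroup law of the heat factor and additivity of the time integral (Leray 1934, §19;
Lemarié-Rieusset 2016, §8.5). [folklore] -/
theorem PicardHyp.isFourierMild_limit (h : PicardHyp c K₀ R a) (hT : T = picardTime ι c K₀ R)
    (hdec : ∀ K : ℕ, ∃ A : ℝ, HasDecay K A a) (hdiv : ∀ ξ, ∑ l, (ξ l : ℂ) * a ξ l = 0)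
    (hconj : ∀ ξ l, a (-ξ) l = conj (a ξ l)) :
    IsFourierMild c K₀ 0 T (picardLimit c T a) := by
  have hTpos : 0 < T := hT ▸ h.time_pos
  set v := picardLimit c T a with hv
  have hvc : Continuous (uncurry v) := h.continuous_limit hT
  have hvd : ∀ s, HasDecay K₀ R (v s) := h.decay_limit hT
  refine
    { hc := h.hc
      hK₀ := h.hK₀
      le := hTpos.le
      cont := hvc
      decay := fun K => ?_
      duhamel := ?_
      divFree := h.sum_mul_limit hT hdiv
      conjSymm := h.limit_conj_symm hT hconj }
  · obtain ⟨A, hA⟩ := hdec K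
    exact ⟨_, h.decay_limit_high' hT hA⟩
  · intro s t hs hst ht ξ
    have htI : t ∈ Icc 0 T := ⟨hs.trans hst, ht⟩
    have hsI : s ∈ Icc 0 T := ⟨hs, hst.trans ht⟩
    -- the fixed-point identity at `t` and at `s`
    have hFt : v t ξ = heat c ξ t • a ξ -
        ∫ r in (0 : ℝ)..t, heat c ξ (t - r) • nonlin (v r) (v r) ξ := by
      have := h.fixed hT t ξ
      rw [duhamel, clamp_of_mem htI] at this
      exact this
    have hFs : v s ξ = heat c ξ s • a ξ -
        ∫ r in (0 : ℝ)..s, heat c ξ (s - r) • nonlin (v r) (v r) ξ := by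
      have := h.fixed hT s ξ
      rw [duhamel, clamp_of_mem hsI] at this
      exact this
    have hint : ∀ a' b' : ℝ, IntervalIntegrable
        (fun r => heat c ξ (t - r) • nonlin (v r) (v r) ξ) volume a' b' := fun a' b' =>
      (continuous_duhamel_integrand_time h.hK₀ hvc hvd t ξ).intervalIntegrable _ _
    rw [hFt, hFs, smul_sub, smul_smul, ← heat_add, show t - s + s = t by ring,
      ← intervalIntegral.integral_smul,
      ← intervalIntegral.integral_add_adjacent_intervals (hint 0 s) (hint s t)]
    have hI : ∫ r in (0 : ℝ)..s, heat c ξ (t - s) • heat c ξ (s - r) • nonlin (v r) (v r) ξ =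
        ∫ r in (0 : ℝ)..s, heat c ξ (t - r) • nonlin (v r) (v r) ξ := by
      refine intervalIntegral.integral_congr fun r _ => ?_
      simp only [smul_smul, ← heat_sub_sub]
    rw [hI]
    abel

end Picard

end Literature.Analysis.FluidPDE.FourierNS

end
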